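import Summits.Ventures.PercRepro.SixFourResidueFourBetaLong

/-!
# `PlaneAddTwoFour` — Theorem 21.6 at `t = 4` for every plane size, part 5: the `p ≥ 101` tail (p1, gen 7 — the `t = 4` twin of mine-2's §21.20)

The one-long-line certificate `BetaCert4N p (−p·2^h) 1`, `h = ⌊(p+1)/2⌋`, holds for every `p ≥ 101`
(`betaCert4_tail`).  The combinatorial content is three window facts on p2's `smallTot` / `collCount`
(`smallTot_le_eps`: `smallTot n p 3 ≤ ε(n)`; `collCount_le_smallTot`: `collCount m ≤ smallTot m p 3` for `m < p`;
`eps_le_collCount_add`: `ε(m) ≤ collCount m + (m + 1)`) and `δ(m) + C(m,3) = ε(m)`; the rest is arithmetic: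
* short lines `3 ≤ m ≤ h`: `B30 p m ≥ −(159 + 50p)·2^m ≥ −30p·2^h·C(m,2)` (`C(m,2) ≥ 3`);
* `A30 p ≥ 48·ε(p) − 81·C(p,3) ≥ 48·2^p − 48(1 + p + C(p,2)) − 81·C(p,3)`;
* long lines `h < m₁ = p − j < p`: `B30 p m₁ ≥ −(50j − 24)·2^{m₁} − 144p ≥ −19·2^p − 144p` (`50j − 24 ≤ 19·2^j`);
* `30p·2^h·C(p,2) ≤ 2^p/5` from `45000·p⁶ ≤ 2^p` (`p ≥ 101`) and `2^{2h} ≤ 2^{p+1}`,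
so `48 − 19 − 1/5 − ε > 0` closes every condition.
-/

namespace PercRepro.SixFour

/-! ## The window facts -/

/-- `Σ_{j ∈ [3, p]} C(n, j) = ε(n)` for `n ≤ p`, `3 ≤ p`. -/
theorem sum_choose_filter_three_le {n p : ℕ} (hn : n ≤ p) (hp : 3 ≤ p) :
    ∑ j ∈ (Finset.range (p + 1)).filter (fun j => 3 ≤ j), n.choose j = eps n := by
  have hsplit := Finset.sum_filter_add_sum_filter_not (Finset.range (p + 1)) (fun j => 3 ≤ j) (fun j => n.choose j)
  have htot : ∑ j ∈ Finset.range (p + 1), n.choose j = 2 ^ n := by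
    rw [← Finset.sum_range_add_sum_Ico _ (Nat.succ_le_succ hn), Nat.sum_range_choose]
    rw [Finset.sum_eq_zero (fun j hj => Nat.choose_eq_zero_of_lt (by rw [Finset.mem_Ico] at hj; omega)), add_zero]
  have hsmall : ∑ j ∈ (Finset.range (p + 1)).filter (fun j => ¬ 3 ≤ j), n.choose j = 1 + n + n.choose 2 := by
    have heq : (Finset.range (p + 1)).filter (fun j => ¬ 3 ≤ j) = Finset.range 3 := by
      ext j
      simp only [Finset.mem_filter, Finset.mem_range]
      omega
    rw [heq]
    simp [Finset.sum_range_succ]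
  have hle : 1 + n + n.choose 2 ≤ 2 ^ n := by omega
  unfold eps
  omega

/-- `smallTot n p 3 ≤ ε(n)` for `n ≤ p`, `3 ≤ p`. -/
theorem smallTot_le_eps {n p : ℕ} (hn : n ≤ p) (hp : 3 ≤ p) : smallTot n p 3 ≤ eps n := by
  rw [← sum_choose_filter_three_le hn hp]
  unfold smallTot
  refine Finset.sum_le_sum_of_subset (fun j hj => ?_)
  rw [Finset.mem_filter] at hj ⊢
  exact ⟨hj.1, hj.2.1⟩

/-- `collCount m ≤ smallTot m p 3` for `m < p`. -/
theorem collCount_le_smallTot {m p : ℕ} (hm : m < p) : collCount m ≤ smallTot m p 3 := by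
  unfold collCount smallTot
  refine Finset.sum_le_sum_of_subset (fun j hj => ?_)
  rw [Finset.mem_filter, Finset.mem_range] at hj ⊢
  omega

/-- `ε(m) ≤ collCount m + (m + 1)` for `3 ≤ m`. -/
theorem eps_le_collCount_add {m : ℕ} (hm : 3 ≤ m) : eps m ≤ collCount m + (m + 1) := by
  rw [← sum_choose_filter_three_le (le_refl m) hm]
  set S := (Finset.range (m + 1)).filter (fun j => 3 ≤ j) with hS
  have hsplit := Finset.sum_filter_add_sum_filter_not S (fun j => j + 2 ≤ m) (fun j => m.choose j)
  have h1 : ∑ j ∈ S.filter (fun j => j + 2 ≤ m), m.choose j = collCount m := by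
    unfold collCount
    rw [hS, Finset.filter_filter]
  have h2 : ∑ j ∈ S.filter (fun j => ¬ j + 2 ≤ m), m.choose j ≤ m + 1 := by
    have hsub : S.filter (fun j => ¬ j + 2 ≤ m) ⊆ {m - 1, m} := by
      intro j hj
      rw [hS, Finset.filter_filter, Finset.mem_filter, Finset.mem_range] at hj
      rw [Finset.mem_insert, Finset.mem_singleton]
      omega
    refine (Finset.sum_le_sum_of_subset hsub).trans ?_
    rw [Finset.sum_pair (by omega : m - 1 ≠ m), Nat.choose_self]
    have : m.choose (m - 1) = m := by
      rw [Nat.choose_symm (by omega : 1 ≤ m)]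
      exact Nat.choose_one_right m
    omega
  omega

/-- `1 + m + C(m,2) + C(m,3) ≤ 2^m` (the four smallest binomial coefficients). -/
theorem S3_le_two_pow' (m : ℕ) : 1 + m + m.choose 2 + m.choose 3 ≤ 2 ^ m := by
  rcases Nat.lt_or_ge m 3 with h | h
  · interval_cases m <;> decide
  · rw [← Nat.sum_range_choose m]
    calc 1 + m + m.choose 2 + m.choose 3 = ∑ j ∈ Finset.range 4, m.choose j := by
          simp [Finset.sum_range_succ]
      _ ≤ ∑ j ∈ Finset.range (m + 1), m.choose j :=
          Finset.sum_le_sum_of_subset (fun x hx => by rw [Finset.mem_range] at hx ⊢; omega)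

/-- `δ(m) + C(m,3) = ε(m)`. -/
theorem delta_add_choose_three (m : ℕ) : delta m + m.choose 3 = eps m := by
  unfold delta eps S3
  have h := S3_le_two_pow' m
  omega

/-- `ε(m) ≤ 2^m`. -/
theorem eps_le_two_pow' (m : ℕ) : eps m ≤ 2 ^ m := Nat.sub_le _ _

/-- `smallTot n p 3 = 0` for `n ≤ 2`. -/
theorem smallTot_eq_zero_of_le_two {n p : ℕ} (hn : n ≤ 2) : smallTot n p 3 = 0 := by
  unfold smallTot
  refine Finset.sum_eq_zero (fun j hj => ?_)
  rw [Finset.mem_filter] at hj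
  exact Nat.choose_eq_zero_of_lt (by omega)

/-- `B30 p m = 0` for `m ≤ 2`. -/
theorem B30_eq_zero_of_le_two {p m : ℕ} (hm : m ≤ 2) : B30 p m = 0 := by
  unfold B30
  rw [smallTot_eq_zero_of_le_two hm]
  interval_cases m <;> simp [delta, eps, collCount, S3]

/-! ## The numeric facts -/

/-- `(n + 1)^6 ≤ 2·n^6` for `n ≥ 10`. -/
theorem succ_pow_six_le {n : ℕ} (hn : 10 ≤ n) : (n + 1) ^ 6 ≤ 2 * n ^ 6 := by
  have h : (10 * (n + 1)) ^ 6 ≤ (11 * n) ^ 6 := Nat.pow_le_pow_left (by omega) 6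
  rw [mul_pow, mul_pow] at h
  have h' : 10 ^ 6 * (n + 1) ^ 6 ≤ 10 ^ 6 * (2 * n ^ 6) := by
    calc 10 ^ 6 * (n + 1) ^ 6 ≤ 11 ^ 6 * n ^ 6 := h
      _ ≤ 10 ^ 6 * (2 * n ^ 6) := by norm_num; omega
  exact Nat.le_of_mul_le_mul_left h' (by norm_num)

/-- `45000·p^6 ≤ 2^p` for `p ≥ 101`. -/
theorem two_pow_ge_pow_six {p : ℕ} (hp : 101 ≤ p) : 45000 * p ^ 6 ≤ 2 ^ p := by
  induction p, hp using Nat.le_induction with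
  | base => norm_num
  | succ n hn ih =>
    calc 45000 * (n + 1) ^ 6 ≤ 45000 * (2 * n ^ 6) := Nat.mul_le_mul_left _ (succ_pow_six_le (by omega))
      _ = 2 * (45000 * n ^ 6) := by ring
      _ ≤ 2 * 2 ^ n := Nat.mul_le_mul_left _ ih
      _ = 2 ^ (n + 1) := by rw [pow_succ]; ring

/-- `50·j − 24 ≤ 19·2^j` for `j ≥ 2` (in `ℤ`; equality at `j = 2`). -/
theorem long_line_coeff_two {j : ℕ} (hj : 2 ≤ j) : (50 * j - 24 : ℤ) ≤ 19 * 2 ^ j := by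
  induction j, hj using Nat.le_induction with
  | base => norm_num
  | succ n hn ih =>
    have h4 : (4 : ℤ) ≤ 2 ^ n := by
      calc (4 : ℤ) = 2 ^ 2 := by norm_num
        _ ≤ 2 ^ n := pow_le_pow_right₀ (by norm_num) hn
    push_cast
    rw [pow_succ]
    nlinarith [ih, h4]

/-- `50·j − 24 ≤ 19·2^j` for `j ≥ 1` (in `ℤ`). -/
theorem long_line_coeff {j : ℕ} (hj : 1 ≤ j) : (50 * j - 24 : ℤ) ≤ 19 * 2 ^ j := by
  rcases Nat.lt_or_ge j 2 with h | h
  · have : j = 1 := by omega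
    subst this
    norm_num
  · exact long_line_coeff_two h

/-- `30·p·2^h·C(p,2) ≤ 2^p/5` for `p ≥ 101`, `h = (p + 1)/2` (in `ℚ`). -/
theorem thirty_p_two_pow_h_le {p : ℕ} (hp : 101 ≤ p) :
    (30 : ℚ) * p * 2 ^ ((p + 1) / 2) * (p.choose 2 : ℚ) ≤ 2 ^ p / 5 := by
  set h := (p + 1) / 2 with hh
  have hsq : (2 : ℚ) ^ h * 2 ^ h ≤ 2 * 2 ^ p := by
    rw [← pow_add]
    have : h + h ≤ p + 1 := by omega
    calc (2 : ℚ) ^ (h + h) ≤ 2 ^ (p + 1) := pow_le_pow_right₀ (by norm_num) this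
      _ = 2 * 2 ^ p := by rw [pow_succ]; ring
  have hC : (p.choose 2 : ℚ) ≤ (p : ℚ) ^ 2 := by exact_mod_cast Nat.choose_le_pow p 2
  have hC0 : (0 : ℚ) ≤ p.choose 2 := by positivity
  have h6 : (45000 : ℚ) * (p : ℚ) ^ 6 ≤ 2 ^ p := by exact_mod_cast two_pow_ge_pow_six hp
  set X := (p : ℚ) * 2 ^ h * (p.choose 2 : ℚ) with hX
  have hX0 : 0 ≤ X := by positivity
  have hp0 : (0 : ℚ) ≤ p := by positivity
  have h2h : (0 : ℚ) ≤ 2 ^ h := by positivity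
  -- `X² ≤ p²·C(p,2)²·2·2^p ≤ 2·p⁶·2^p ≤ (2^p)²/22500`
  have hX2 : X * X ≤ (2 ^ p : ℚ) * 2 ^ p / 22500 := by
    have e : X * X = ((p : ℚ) ^ 2 * (p.choose 2 : ℚ) ^ 2) * (2 ^ h * 2 ^ h) := by rw [hX]; ring
    rw [e]
    have hpc : (p : ℚ) ^ 2 * (p.choose 2 : ℚ) ^ 2 ≤ (p : ℚ) ^ 6 := by
      have : (p.choose 2 : ℚ) ^ 2 ≤ ((p : ℚ) ^ 2) ^ 2 := pow_le_pow_left₀ hC0 hC 2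
      calc (p : ℚ) ^ 2 * (p.choose 2 : ℚ) ^ 2 ≤ (p : ℚ) ^ 2 * ((p : ℚ) ^ 2) ^ 2 :=
            mul_le_mul_of_nonneg_left this (by positivity)
        _ = (p : ℚ) ^ 6 := by ring
    have h2p : (0 : ℚ) ≤ 2 ^ p := by positivity
    calc (p : ℚ) ^ 2 * (p.choose 2 : ℚ) ^ 2 * (2 ^ h * 2 ^ h) ≤ (p : ℚ) ^ 6 * (2 * 2 ^ p) :=
          mul_le_mul hpc hsq (by positivity) (by positivity)
      _ ≤ (2 ^ p / 45000) * (2 * 2 ^ p) := by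
          apply mul_le_mul_of_nonneg_right _ (by positivity)
          linarith
      _ = (2 ^ p : ℚ) * 2 ^ p / 22500 := by ring
  have hY : X ≤ (2 ^ p : ℚ) / 150 := by
    have hY0 : (0 : ℚ) ≤ (2 ^ p : ℚ) / 150 := by positivity
    nlinarith [hX2, hX0, hY0]
  calc (30 : ℚ) * p * 2 ^ h * (p.choose 2 : ℚ) = 30 * X := by rw [hX]; ring
    _ ≤ 30 * ((2 ^ p : ℚ) / 150) := by linarith
    _ = 2 ^ p / 5 := by ring

/-! ## The tail certificate -/

/-- **The `p ≥ 101` certificate at `t = 4`**: `BetaCert4N p (−p·2^h) 1` with `h = ⌊(p + 1)/2⌋`. -/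
theorem betaCert4_tail {p : ℕ} (hp : 101 ≤ p) : BetaCert4N p (-(p : ℤ) * 2 ^ ((p + 1) / 2)) 1 := by
  set h := (p + 1) / 2 with hh
  have hp0 : (0 : ℤ) ≤ p := by positivity
  have h2h : (0 : ℤ) ≤ 2 ^ h := by positivity
  have h2p : (0 : ℤ) < 2 ^ p := by positivity
  -- the `ℚ` fact `30·p·2^h·C(p,2) ≤ 2^p/5`, transported to `ℤ` as `150·p·2^h·C(p,2) ≤ 2^p`
  have hkey : 150 * (p : ℤ) * 2 ^ h * (p.choose 2 : ℤ) ≤ 2 ^ p := by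
    have := thirty_p_two_pow_h_le hp
    rw [← hh] at this
    have h' : (150 : ℚ) * p * 2 ^ h * (p.choose 2 : ℚ) ≤ 2 ^ p := by linarith
    exact_mod_cast h'
  -- `A30 p ≥ 48·2^p − 48(1 + p + C(p,2)) − 81·C(p,3)`
  have hA : 48 * (2 : ℤ) ^ p - 48 * (1 + p + (p.choose 2 : ℤ)) - 81 * (p.choose 3 : ℤ) ≤ A30 p := by
    unfold A30
    have hs : (smallTot p p 3 : ℤ) ≤ eps p := by exact_mod_cast smallTot_le_eps (le_refl p) (by omega)
    have hd : (delta p : ℤ) + (p.choose 3 : ℤ) = eps p := by exact_mod_cast delta_add_choose_three p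
    have he : (eps p : ℤ) = 2 ^ p - (1 + p + (p.choose 2 : ℤ)) := by
      unfold eps
      have := S3_le_two_pow' p
      have h' : 1 + p + p.choose 2 ≤ 2 ^ p := by omega
      rw [Nat.cast_sub h']
      push_cast
      ring
    linarith
  -- the polynomial terms against `2^p`: `48(1 + p + C(p,2)) + 81·C(p,3) + 144·p ≤ 2^p/100`
  have hpoly : 100 * (48 * (1 + p + (p.choose 2 : ℤ)) + 81 * (p.choose 3 : ℤ) + 144 * p) ≤ 2 ^ p := by
    have hC2 : (p.choose 2 : ℤ) ≤ (p : ℤ) ^ 2 := by exact_mod_cast Nat.choose_le_pow p 2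
    have hC3 : (p.choose 3 : ℤ) ≤ (p : ℤ) ^ 3 := by exact_mod_cast Nat.choose_le_pow p 3
    have h6 : 45000 * (p : ℤ) ^ 6 ≤ 2 ^ p := by exact_mod_cast two_pow_ge_pow_six hp
    have hp101 : (101 : ℤ) ≤ p := by exact_mod_cast hp
    nlinarith [hC2, hC3, h6, hp101, pow_pos (show (0 : ℤ) < p by omega) 3]
  refine ⟨by norm_num, by nlinarith, ?_, ?_, ?_⟩
  · -- (c1) the short lines
    intro m hm hm2
    rw [Nat.cast_one, one_mul]
    rcases Nat.lt_or_ge m 3 with hm3 | hm3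
    · rw [B30_eq_zero_of_le_two (by omega)]
      have h0 : (0 : ℤ) ≤ (p : ℤ) * 2 ^ h * (m.choose 2 : ℤ) := by positivity
      have e : 30 * (-(p : ℤ) * 2 ^ h) * (m.choose 2 : ℤ) = -30 * ((p : ℤ) * 2 ^ h * (m.choose 2 : ℤ)) := by ring
      rw [e]
      linarith
    · have hB : -(159 + 50 * (p : ℤ)) * 2 ^ m ≤ B30 p m := by
        unfold B30
        have e1 : (m.choose 3 : ℤ) ≤ 2 ^ m := by
          have := delta_add_choose_three m
          have := eps_le_two_pow' m
          exact_mod_cast (by omega : m.choose 3 ≤ 2 ^ m)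
        have e2 : (delta m : ℤ) ≤ 2 ^ m := by
          have := delta_add_choose_three m
          have := eps_le_two_pow' m
          exact_mod_cast (by omega : delta m ≤ 2 ^ m)
        have e3 : (eps m : ℤ) ≤ 2 ^ m := by exact_mod_cast eps_le_two_pow' m
        have e4 : ((p - m : ℕ) : ℤ) ≤ p := by exact_mod_cast Nat.sub_le p m
        have e5 : (0 : ℤ) ≤ (smallTot m p 3 : ℤ) + (collCount m : ℤ) := by positivity
        have e6 : (0 : ℤ) ≤ (eps m : ℤ) := by positivity
        have e7 : (0 : ℤ) ≤ ((p - m : ℕ) : ℤ) := by positivity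
        nlinarith [mul_le_mul e3 e4 e7 (by positivity : (0 : ℤ) ≤ 2 ^ m)]
      have h2m : (2 : ℤ) ^ m ≤ 2 ^ h := pow_le_pow_right₀ (by norm_num) (by omega)
      have hC : (3 : ℤ) ≤ (m.choose 2 : ℤ) := by
        have := Nat.choose_le_choose 2 hm3
        exact_mod_cast (by simpa using this : 3 ≤ m.choose 2)
      have h2m0 : (0 : ℤ) ≤ 2 ^ m := by positivity
      -- `(159 + 50p)·2^m ≤ 90p·2^m ≤ 30p·C(m,2)·2^m ≤ 30p·C(m,2)·2^h`
      have hp101 : (101 : ℤ) ≤ p := by exact_mod_cast hp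
      have s1 : (159 + 50 * (p : ℤ)) * 2 ^ m ≤ 30 * p * (m.choose 2 : ℤ) * 2 ^ m := by
        have : (159 + 50 * (p : ℤ)) ≤ 30 * p * (m.choose 2 : ℤ) := by nlinarith
        exact mul_le_mul_of_nonneg_right this h2m0
      have s2 : 30 * (p : ℤ) * (m.choose 2 : ℤ) * 2 ^ m ≤ 30 * p * (m.choose 2 : ℤ) * 2 ^ h :=
        mul_le_mul_of_nonneg_left h2m (by positivity)
      nlinarith [hB, s1, s2]
  · -- (c2) no long line
    rw [Nat.cast_one, one_mul]
    nlinarith [hA, hkey, hpoly]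
  · -- (c3) one long line `m₁ = p − j`, `h < m₁ < p`
    intro m₁ hm₁ hlong
    rw [Nat.cast_one, one_mul]
    have hm3 : 3 ≤ m₁ := by omega
    have hB : -19 * (2 : ℤ) ^ p - 144 * p ≤ B30 p m₁ := by
      unfold B30
      have e1 : (collCount m₁ : ℤ) ≤ smallTot m₁ p 3 := by exact_mod_cast collCount_le_smallTot hm₁
      have e2 : (eps m₁ : ℤ) ≤ (collCount m₁ : ℤ) + (m₁ + 1) := by exact_mod_cast eps_le_collCount_add hm3
      have e3 : (delta m₁ : ℤ) + (m₁.choose 3 : ℤ) = eps m₁ := by exact_mod_cast delta_add_choose_three m₁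
      have e4 : (eps m₁ : ℤ) ≤ 2 ^ m₁ := by exact_mod_cast eps_le_two_pow' m₁
      have e5 : (0 : ℤ) ≤ (m₁.choose 3 : ℤ) := by positivity
      have e6 : (0 : ℤ) ≤ (eps m₁ : ℤ) := by positivity
      -- the long-line coefficient: `(50j − 24)·2^{m₁} ≤ 19·2^p` for `j = p − m₁ ≥ 1`
      set j := p - m₁ with hj
      have hj1 : 1 ≤ j := by omega
      have hpm : ((p - m₁ : ℕ) : ℤ) = (j : ℤ) := by rw [hj]
      have hcoef : (50 * (j : ℤ) - 24) * 2 ^ m₁ ≤ 19 * 2 ^ p := by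
        have h1 := long_line_coeff hj1
        have h2 : (2 : ℤ) ^ p = 2 ^ j * 2 ^ m₁ := by
          rw [← pow_add]
          congr 1
          omega
        have h2m : (0 : ℤ) ≤ 2 ^ m₁ := by positivity
        rw [h2]
        nlinarith [mul_le_mul_of_nonneg_right h1 h2m]
      have hm1p : (m₁ : ℤ) + 1 ≤ p := by exact_mod_cast hm₁
      rw [hpm]
      -- `B30 ≥ 81·C(m₁,3) + 24·ε − 50·j·ε − 144(m₁+1) ≥ −(50j − 24)·ε − 144p ≥ −(50j − 24)·2^{m₁} − 144p`
      have hj0 : (1 : ℤ) ≤ j := by exact_mod_cast hj1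
      have hneg : (0 : ℤ) ≤ 50 * (j : ℤ) - 24 := by linarith
      nlinarith [mul_le_mul_of_nonneg_left e4 hneg, hcoef, e1, e2, e3, e5, e6, hm1p]
    have hC : (0 : ℤ) ≤ (m₁.choose 2 : ℤ) := by positivity
    have hCp : (0 : ℤ) ≤ (p.choose 2 : ℤ) := by positivity
    have hmono : -((p : ℤ) * 2 ^ h) * ((p.choose 2 : ℤ) - (m₁.choose 2 : ℤ)) ≥ -((p : ℤ) * 2 ^ h) * (p.choose 2 : ℤ) := by
      have : (0 : ℤ) ≤ (p : ℤ) * 2 ^ h := by positivity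
      nlinarith
    nlinarith [hA, hB, hkey, hpoly, hmono]

end PercRepro.SixFour
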